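import Literature.Probability.LatticeModels.GlauberLogSobolevBoxStep
import Literature.Probability.LatticeModels.FatRectangleBoxes
import HarnessLib

/-!
# The scale step of [Mar99] Theorem 4.6 on fat rectangles, PROVED (explicit-parameter form)

Topic `Literature/Probability/LatticeModels`; cell `ym-ir`, seat lit-3 (census rows B2/B4).  Theorems only
(D-0026).  [Mar99] F. Martinelli, LNM 1717 (1999), Theorem 4.6, proof p0190 L18 – p0192 L1, in the language of
the typed fact `Glauber.Martinelli1999_thm4_6` (`d = 2`, `𝓡_L = fatRectangles L`, `SMT` on all fat
rectangles); this file is the log-Sobolev twin of the tree's `FatRectanglePoincareStep` (Theorem 4.5):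
* `Glauber.logSobolevIneq_box_of_halves_fat` — the box step `logSobolevIneq_box_of_halves` with the `SMT`
  input taken from FAT RECTANGLES (the `ρ`-boxes inside the overlap strips are fat for `ρ ≥ 2r`), the error
  uniformised through a bound `M` on the volume, and the boundary-gradient bound (4.28) taken from its
  uniform form on all fat rectangles (Corollary 4.9, the hypothesis `hGB`);
* `Glauber.fatRectangles_logSobolev_step` — (4.25) and «one argues at this point exactly as in the proof of
  Theorem 4.5» (p0191 L26–27) in one statement: if every `R ∈ 𝓡_{L'}` satisfies a log-Sobolev inequality
  with constant `c_s` (all boundary conditions), then every `R ∈ 𝓡_{L''}`, `3L'' ≤ 4L'`, satisfies one with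
  constant `F² c_s`, `F = e² ((1 + η)(1 + 1/N) + k₁/N)` the factor of the box step at volume `M = 4L'²`, for
  any admissible parameters `(δ, ρ, N)` at scale `L'` (period `δ + r` of the strips, `12(N(δ+r) + (δ+r)) ≤ L'`,
  `10(ρ+1) ≤ L'`).  Rectangles longer than `L'` in one direction are halved along it, those longer in both
  directions twice; halving along the LONGEST side keeps fatness (as in the Theorem 4.5 file).
SIBLING-SETTING result (`±1` spins, range `r`); the Yang–Mills gap is not touched.
[cite: Martinelli1999, Theorem 4.6, proof, (4.20)–(4.25)]
-/

open MeasureTheory ProbabilityTheory Finset Filter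

noncomputable section

namespace Literature.Probability.LatticeModels

namespace Glauber

variable {r : ℕ} (U : FRPotential 2 ℤˣ r) (β : ℝ)

/-- `κ ↦ (1 − κ/(1−κ))⁻¹` is monotone on `[0, ½)`, squared. [folklore] -/
private theorem inv_one_sub_div_sq_mono {x y : ℝ} (hx : 0 ≤ x) (hxy : x ≤ y) (hy : y < 1 / 2) :
    ((1 - x / (1 - x))⁻¹) ^ 2 ≤ ((1 - y / (1 - y))⁻¹) ^ 2 := by
  have h1 : x / (1 - x) ≤ y / (1 - y) := by
    rw [div_le_div_iff₀ (by linarith) (by linarith)]; nlinarith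
  have hy1 : y / (1 - y) < 1 := by rw [div_lt_one (by linarith)]; linarith
  have hx0 : 0 ≤ x / (1 - x) := div_nonneg hx (by linarith)
  have h2 : (1 - x / (1 - x))⁻¹ ≤ (1 - y / (1 - y))⁻¹ := inv_anti₀ (by linarith) (by linarith)
  exact pow_le_pow_left₀ (inv_nonneg.2 (by linarith)) h2 2

set_option maxHeartbeats 1600000 in
/-- **The box step with fat-rectangle inputs** ([Mar99] Theorem 4.6, proof, (4.20)–(4.25), `d = 2`): as
`logSobolevIneq_box_of_halves`, with `SMT(·, l, m)` assumed on all fat rectangles, the two-block error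
uniformised through a bound `M ≥ |Q|`, and the boundary-gradient bound (4.28) (constants `(k, m')`) assumed on
all fat rectangles and used on the parts `R_n^{bot}` (assumed fat).
[cite: Martinelli1999, Theorem 4.6, proof, (4.20)–(4.25)] -/
theorem logSobolevIneq_box_of_halves_fat {R : ℝ} (hR1 : 1 ≤ R)
    (hR : ∀ (Λ : Finset (Site 2)) (y : Site 2) (σ : Site 2 → ℤˣ),
      R⁻¹ ≤ flipWeight U β Λ y σ ∧ flipWeight U β Λ y σ ≤ R)
    {lS : ℕ} {m : ℝ} (hm : 0 < m) (hSMT : ∀ L : ℕ, ∀ Q ∈ fatRectangles L, SMT (U.spec β) Q lS m)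
    {a b : Site 2} {j : Fin 2} {c : ℤ} {δ N ρ : ℕ} (hN : 0 < N) (hδ0 : 0 < δ) (hc : a j ≤ c)
    (hend : c + N * (δ + r) ≤ b j) (hρ2 : 2 * r ≤ ρ) (hρδ : ρ + r ≤ δ) (hρl : lS + 2 * r ≤ ρ)
    (hwide : ∀ i, i ≠ j → (ρ : ℤ) + 1 ≤ b i - a i)
    {M : ℕ} (hM : ((Fintype.piFinset fun i => Finset.Ico ((a) i) ((b) i))).card ≤ M) {κ : ℝ}
    (hκdef : κ = (1 + R ^ 6 * (2 * r + 1 : ℝ) ^ 2 * (2 * r + 1 : ℝ) ^ 2 * M *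
        ((2 * (ρ + r) + 1) ^ 2 : ℕ) * Real.exp (-(m * ((ρ : ℝ) - 2 * r)))) ^ M - 1)
    (hκ : κ < 1 / 2) {k m' : ℝ} (hk : 0 ≤ k) (hm' : 0 < m')
    (hGB : ∀ L : ℕ, ∀ Q ∈ fatRectangles L, ∀ (σ : Site 2 → ℤˣ) (x : Site 2), x ∉ Q →
      ∀ f : (Site 2 → ℤˣ) → ℝ, Measurable f → ∀ C : ℝ, (∀ σ, |f σ| ≤ C) →
        (Real.sqrt (∫ ω, f ω ^ 2 ∂(U.spec β Q (spinFlip x σ))) -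
            Real.sqrt (∫ ω, f ω ^ 2 ∂(U.spec β Q σ))) ^ 2 ≤
          k * (∫ ω, siteGrad x f ω ^ 2 ∂(U.spec β Q σ) +
            ∑ y ∈ Q, Real.exp (-(m' * (supDist x y : ℝ))) * ∫ ω, siteGrad y f ω ^ 2 ∂(U.spec β Q σ)))
    {Lb : ℕ} (hBotFat : ∀ n : ℕ, n < N →
      (Fintype.piFinset fun i => Finset.Ico ((a) i) ((Function.update b j (c + n * (δ + r) + δ)) i)) ∈
        fatRectangles Lb)
    {cs : ℝ} (hcs : 0 ≤ cs)
    (hTop : ∀ n : ℕ, n < N → ∀ φ : Site 2 → ℤˣ,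
      LogSobolevIneq (U.spec β (Fintype.piFinset fun i => Finset.Ico ((Function.update a j (c + n * (δ + r))) i) ((b) i)) φ)
        (Fintype.piFinset fun i => Finset.Ico ((Function.update a j (c + n * (δ + r))) i) ((b) i)) cs)
    (hBot : ∀ n : ℕ, n < N → ∀ φ : Site 2 → ℤˣ,
      LogSobolevIneq (U.spec β (Fintype.piFinset fun i => Finset.Ico ((a) i) ((Function.update b j (c + n * (δ + r) + δ)) i)) φ)
        (Fintype.piFinset fun i => Finset.Ico ((a) i) ((Function.update b j (c + n * (δ + r) + δ)) i)) cs)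
    (τ : Site 2 → ℤˣ) :
    LogSobolevIneq (U.spec β (Fintype.piFinset fun i => Finset.Ico ((a) i) ((b) i)) τ)
      (Fintype.piFinset fun i => Finset.Ico ((a) i) ((b) i))
      (((1 - κ / (1 - κ))⁻¹) ^ 2 * cs *
        ((1 + k * (2 * (1 - Real.exp (-(m' / 2 / 2)))⁻¹) ^ 2 * Real.exp (-(m' / 2 * δ))) * (1 + 1 / N) +
          k * (1 + (2 * (1 - Real.exp (-(m' / 2)))⁻¹) ^ 2) / N)) := by
  classical
  -- the `SMT` input on ρ-boxes
  have hρr : r ≤ ρ := by omega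
  have hSMT' : ∀ a' b' : Site 2, (∀ i, (ρ : ℤ) + 1 - r ≤ b' i - a' i ∧ b' i - a' i ≤ 2 * ρ + 1) →
      SMT (U.spec β) (Fintype.piFinset fun i => Finset.Ico ((a') i) ((b') i)) lS m := by
    intro a' b' h
    refine hSMT (2 * ρ + 1) _ (IcoBox_mem_fatRectangles (fun i => ?_) (fun i i' => ?_) (fun i => ?_))
    · have := (h i).1
      have hρr' : (r : ℤ) ≤ ρ := by exact_mod_cast hρr
      linarith
    · have h1 := (h i).2
      have h2 := (h i').1
      have hρ2' : (2 * r : ℤ) ≤ ρ := by exact_mod_cast hρ2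
      nlinarith
    · have := (h i).2
      push_cast
      linarith
  -- the error of this box is at most `κ`
  set κQ := (1 + R ^ 6 * (2 * r + 1 : ℝ) ^ 2 * (2 * r + 1 : ℝ) ^ 2 *
      ((Fintype.piFinset fun i => Finset.Ico ((a) i) ((b) i))).card *
      ((2 * (ρ + r) + 1) ^ 2 : ℕ) * Real.exp (-(m * ((ρ : ℝ) - 2 * r)))) ^
      ((Fintype.piFinset fun i => Finset.Ico ((a) i) ((b) i))).card - 1 with hκQ
  have hκQκ : κQ ≤ κ := by
    rw [hκQ, hκdef]
    refine sub_le_sub_right ?_ 1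
    set α : ℝ := R ^ 6 * (2 * r + 1 : ℝ) ^ 2 * (2 * r + 1 : ℝ) ^ 2 with hα
    set e : ℝ := ((2 * (ρ + r) + 1) ^ 2 : ℕ) * Real.exp (-(m * ((ρ : ℝ) - 2 * r))) with he
    have hMc : ((((Fintype.piFinset fun i => Finset.Ico ((a) i) ((b) i))).card : ℕ) : ℝ) ≤ M := by
      exact_mod_cast hM
    have h0 : α * (((Fintype.piFinset fun i => Finset.Ico ((a) i) ((b) i))).card : ℝ) * e ≤ α * M * e := by
      gcongr
    have h1 : (1 : ℝ) + α * ((Fintype.piFinset fun i => Finset.Ico ((a) i) ((b) i))).card *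
        ((2 * (ρ + r) + 1) ^ 2 : ℕ) * Real.exp (-(m * ((ρ : ℝ) - 2 * r)))
        ≤ 1 + α * M * ((2 * (ρ + r) + 1) ^ 2 : ℕ) * Real.exp (-(m * ((ρ : ℝ) - 2 * r))) := by
      have e1 : α * ((Fintype.piFinset fun i => Finset.Ico ((a) i) ((b) i))).card *
          ((2 * (ρ + r) + 1) ^ 2 : ℕ) * Real.exp (-(m * ((ρ : ℝ) - 2 * r))) =
          α * (((Fintype.piFinset fun i => Finset.Ico ((a) i) ((b) i))).card : ℝ) * e := by rw [he]; ring
      have e2 : α * M * ((2 * (ρ + r) + 1) ^ 2 : ℕ) * Real.exp (-(m * ((ρ : ℝ) - 2 * r))) = α * M * e := by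
        rw [he]; ring
      rw [e1, e2]; linarith
    calc (1 + α * ((Fintype.piFinset fun i => Finset.Ico ((a) i) ((b) i))).card * ((2 * (ρ + r) + 1) ^ 2 : ℕ) *
          Real.exp (-(m * ((ρ : ℝ) - 2 * r)))) ^ ((Fintype.piFinset fun i => Finset.Ico ((a) i) ((b) i))).card
        ≤ (1 + α * M * ((2 * (ρ + r) + 1) ^ 2 : ℕ) * Real.exp (-(m * ((ρ : ℝ) - 2 * r)))) ^
          ((Fintype.piFinset fun i => Finset.Ico ((a) i) ((b) i))).card :=
          pow_le_pow_left₀ (by positivity) h1 _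
      _ ≤ (1 + α * M * ((2 * (ρ + r) + 1) ^ 2 : ℕ) * Real.exp (-(m * ((ρ : ℝ) - 2 * r)))) ^ M :=
          pow_le_pow_right₀ (le_add_of_nonneg_right (by positivity)) hM
  have hκQ2 : κQ < 1 / 2 := lt_of_le_of_lt hκQκ hκ
  have hκQ0 : 0 ≤ κQ := by
    rw [hκQ, sub_nonneg]; exact one_le_pow₀ (le_add_of_nonneg_right (by positivity))
  have hl : (lS : ℝ) ≤ (ρ : ℝ) - 2 * r := by
    have : ((lS + 2 * r : ℕ) : ℝ) ≤ ρ := by exact_mod_cast hρl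
    push_cast at this; linarith
  have hGB' : ∀ n : ℕ, n < N → ∀ (σ : Site 2 → ℤˣ) (x : Site 2),
      x ∉ (Fintype.piFinset fun i => Finset.Ico ((a) i) ((Function.update b j (c + n * (δ + r) + δ)) i)) →
      ∀ f : (Site 2 → ℤˣ) → ℝ, Measurable f → ∀ C : ℝ, (∀ σ, |f σ| ≤ C) →
        (Real.sqrt (∫ ω, f ω ^ 2 ∂(U.spec β
              (Fintype.piFinset fun i => Finset.Ico ((a) i) ((Function.update b j (c + n * (δ + r) + δ)) i))
              (spinFlip x σ))) -
            Real.sqrt (∫ ω, f ω ^ 2 ∂(U.spec β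
              (Fintype.piFinset fun i => Finset.Ico ((a) i) ((Function.update b j (c + n * (δ + r) + δ)) i))
              σ))) ^ 2 ≤
          k * (∫ ω, siteGrad x f ω ^ 2 ∂(U.spec β
              (Fintype.piFinset fun i => Finset.Ico ((a) i) ((Function.update b j (c + n * (δ + r) + δ)) i)) σ) +
            ∑ y ∈ (Fintype.piFinset fun i => Finset.Ico ((a) i) ((Function.update b j (c + n * (δ + r) + δ)) i)),
              Real.exp (-(m' * (supDist x y : ℝ))) * ∫ ω, siteGrad y f ω ^ 2 ∂(U.spec β
                (Fintype.piFinset fun i => Finset.Ico ((a) i) ((Function.update b j (c + n * (δ + r) + δ)) i))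
                σ)) :=
    fun n hn σ x hx f hf C hC => hGB Lb _ (hBotFat n hn) σ x hx f hf C hC
  have key := logSobolevIneq_box_of_halves U β (d := 2) (by norm_num) hR1 hR hN hδ0 hc hend hρr hρδ hwide
    hm.le hl hSMT' hκQ hκQ2 hk hm' hGB' hcs hTop hBot τ
  simp only [Nat.cast_ofNat] at key
  refine key.mono ?_
  have hK₁0 : 0 ≤ (2 * (1 - Real.exp (-(m' / 2)))⁻¹) ^ 2 := sq_nonneg _
  have hK₂0 : 0 ≤ (2 * (1 - Real.exp (-(m' / 2 / 2)))⁻¹) ^ 2 := sq_nonneg _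
  have hN0 : (0 : ℝ) < N := by exact_mod_cast hN
  have hB0 : 0 ≤ cs * ((1 + k * (2 * (1 - Real.exp (-(m' / 2 / 2)))⁻¹) ^ 2 * Real.exp (-(m' / 2 * δ))) *
      (1 + 1 / (N : ℝ)) + k * (1 + (2 * (1 - Real.exp (-(m' / 2)))⁻¹) ^ 2) / N) := by positivity
  have hE := inv_one_sub_div_sq_mono hκQ0 hκQκ hκ
  calc ((1 - κQ / (1 - κQ))⁻¹) ^ 2 * cs *
        ((1 + k * (2 * (1 - Real.exp (-(m' / 2 / 2)))⁻¹) ^ 2 * Real.exp (-(m' / 2 * δ))) * (1 + 1 / (N : ℝ)) +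
          k * (1 + (2 * (1 - Real.exp (-(m' / 2)))⁻¹) ^ 2) / N)
      = ((1 - κQ / (1 - κQ))⁻¹) ^ 2 * (cs *
        ((1 + k * (2 * (1 - Real.exp (-(m' / 2 / 2)))⁻¹) ^ 2 * Real.exp (-(m' / 2 * δ))) * (1 + 1 / (N : ℝ)) +
          k * (1 + (2 * (1 - Real.exp (-(m' / 2)))⁻¹) ^ 2) / N)) := by ring
    _ ≤ ((1 - κ / (1 - κ))⁻¹) ^ 2 * (cs *
        ((1 + k * (2 * (1 - Real.exp (-(m' / 2 / 2)))⁻¹) ^ 2 * Real.exp (-(m' / 2 * δ))) * (1 + 1 / (N : ℝ)) +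
          k * (1 + (2 * (1 - Real.exp (-(m' / 2)))⁻¹) ^ 2) / N)) := mul_le_mul_of_nonneg_right hE hB0
    _ = _ := by ring

set_option maxHeartbeats 4000000 in
/-- **[Mar99] Theorem 4.6, the scale step on fat rectangles**: see the module docstring.  Parameters at scale
`L'`: `δ` (overlap width), `ρ` (`2r ≤ ρ`, `ρ + r ≤ δ`, `l + 2r ≤ ρ`), `N ≥ 1` strips of period `δ + r` with
`12(N(δ+r) + (δ+r)) ≤ L'`, `10(ρ+1) ≤ L'`, `κ̄ < ½` the explicit two-block error at volume `M = 4L'²`, and the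
boundary-gradient bound (4.28) with constants `(k, m')` on all fat rectangles.  Conclusion: log-Sobolev constant
`c_s` on `𝓡_{L'}` (all boundary conditions) implies log-Sobolev constant `F² c_s` on `𝓡_{L''}` whenever
`3L'' ≤ 4L'`, `F = (1 − κ̄/(1−κ̄))⁻² ((1 + k K₂ e^{−m'δ/2})(1 + 1/N) + k(1 + K₁)/N)`,
`K₁ = (2(1 − e^{−m'/2})⁻¹)²`, `K₂ = (2(1 − e^{−m'/4})⁻¹)²`.
[cite: Martinelli1999, Theorem 4.6, proof, (4.20)–(4.25)] -/
theorem fatRectangles_logSobolev_step {R : ℝ} (hR1 : 1 ≤ R)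
    (hR : ∀ (Λ : Finset (Site 2)) (y : Site 2) (σ : Site 2 → ℤˣ),
      R⁻¹ ≤ flipWeight U β Λ y σ ∧ flipWeight U β Λ y σ ≤ R)
    {lS : ℕ} {m : ℝ} (hm : 0 < m) (hSMT : ∀ L : ℕ, ∀ Q ∈ fatRectangles L, SMT (U.spec β) Q lS m)
    {L' δ N ρ : ℕ} (hN : 0 < N) (hδ0 : 0 < δ) (hρ2 : 2 * r ≤ ρ) (hρδ : ρ + r ≤ δ) (hρl : lS + 2 * r ≤ ρ)
    (hNδ : 12 * (N * (δ + r) + (δ + r)) ≤ L') (hρL : 10 * (ρ + 1) ≤ L') {κ : ℝ}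
    (hκdef : κ = (1 + R ^ 6 * (2 * r + 1 : ℝ) ^ 2 * (2 * r + 1 : ℝ) ^ 2 * ((4 * L' ^ 2 : ℕ) : ℝ) *
        ((2 * (ρ + r) + 1) ^ 2 : ℕ) * Real.exp (-(m * ((ρ : ℝ) - 2 * r)))) ^ (4 * L' ^ 2) - 1)
    (hκ : κ < 1 / 2) {k m' : ℝ} (hk : 0 ≤ k) (hm' : 0 < m')
    (hGB : ∀ L : ℕ, ∀ Q ∈ fatRectangles L, ∀ (σ : Site 2 → ℤˣ) (x : Site 2), x ∉ Q →
      ∀ f : (Site 2 → ℤˣ) → ℝ, Measurable f → ∀ C : ℝ, (∀ σ, |f σ| ≤ C) →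
        (Real.sqrt (∫ ω, f ω ^ 2 ∂(U.spec β Q (spinFlip x σ))) -
            Real.sqrt (∫ ω, f ω ^ 2 ∂(U.spec β Q σ))) ^ 2 ≤
          k * (∫ ω, siteGrad x f ω ^ 2 ∂(U.spec β Q σ) +
            ∑ y ∈ Q, Real.exp (-(m' * (supDist x y : ℝ))) * ∫ ω, siteGrad y f ω ^ 2 ∂(U.spec β Q σ)))
    {cs : ℝ} (hcs : 0 ≤ cs)
    (hLSI : ∀ Q ∈ fatRectangles L', ∀ τ : Site 2 → ℤˣ, LogSobolevIneq (U.spec β Q τ) Q cs)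
    {L'' : ℕ} (hL2 : 3 * L'' ≤ 4 * L') :
    ∀ Q ∈ fatRectangles L'', ∀ τ : Site 2 → ℤˣ,
      LogSobolevIneq (U.spec β Q τ) Q
        ((((1 - κ / (1 - κ))⁻¹) ^ 2 *
          ((1 + k * (2 * (1 - Real.exp (-(m' / 2 / 2)))⁻¹) ^ 2 * Real.exp (-(m' / 2 * δ))) * (1 + 1 / N) +
            k * (1 + (2 * (1 - Real.exp (-(m' / 2)))⁻¹) ^ 2) / N)) ^ 2 * cs) := by
  classical
  set F : ℝ := ((1 - κ / (1 - κ))⁻¹) ^ 2 *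
    ((1 + k * (2 * (1 - Real.exp (-(m' / 2 / 2)))⁻¹) ^ 2 * Real.exp (-(m' / 2 * δ))) * (1 + 1 / N) +
      k * (1 + (2 * (1 - Real.exp (-(m' / 2)))⁻¹) ^ 2) / N) with hF
  have hκ0 : 0 ≤ κ := by
    rw [hκdef, sub_nonneg]; exact one_le_pow₀ (le_add_of_nonneg_right (by positivity))
  have hN0 : (0 : ℝ) < N := by exact_mod_cast hN
  have hK₁0 : 0 ≤ (2 * (1 - Real.exp (-(m' / 2)))⁻¹) ^ 2 := sq_nonneg _
  have hK₂0 : 0 ≤ (2 * (1 - Real.exp (-(m' / 2 / 2)))⁻¹) ^ 2 := sq_nonneg _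
  have hE1 : 1 ≤ ((1 - κ / (1 - κ))⁻¹) ^ 2 := by
    refine one_le_pow₀ ?_
    have hε0 : 0 ≤ κ / (1 - κ) := div_nonneg hκ0 (by linarith)
    have hε1 : κ / (1 - κ) < 1 := by rw [div_lt_one (by linarith)]; linarith
    rw [le_inv_comm₀ one_pos (by linarith), inv_one]; linarith
  have hF1 : 1 ≤ F := by
    rw [hF]
    have h1 : (1 : ℝ) ≤ (1 + k * (2 * (1 - Real.exp (-(m' / 2 / 2)))⁻¹) ^ 2 * Real.exp (-(m' / 2 * δ))) *
        (1 + 1 / (N : ℝ)) + k * (1 + (2 * (1 - Real.exp (-(m' / 2)))⁻¹) ^ 2) / N := by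
      have h2 : (1 : ℝ) ≤ 1 + k * (2 * (1 - Real.exp (-(m' / 2 / 2)))⁻¹) ^ 2 * Real.exp (-(m' / 2 * δ)) :=
        le_add_of_nonneg_right (by positivity)
      have h3 : (1 : ℝ) ≤ 1 + 1 / (N : ℝ) := le_add_of_nonneg_right (by positivity)
      have h4 : (0 : ℝ) ≤ k * (1 + (2 * (1 - Real.exp (-(m' / 2)))⁻¹) ^ 2) / N := by positivity
      nlinarith [one_le_mul_of_one_le_of_one_le h2 h3]
    exact one_le_mul_of_one_le_of_one_le hE1 h1
  have hF0 : 0 ≤ F := zero_le_one.trans hF1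
  have hcF : cs ≤ F * cs := le_mul_of_one_le_left hcs hF1
  have hFF : F * cs ≤ F ^ 2 * cs := by
    refine mul_le_mul_of_nonneg_right ?_ hcs
    calc F = F * 1 := (mul_one F).symm
      _ ≤ F * F := mul_le_mul_of_nonneg_left hF1 hF0
      _ = F ^ 2 := (sq F).symm
  -- integer forms of the parameter inequalities
  have hNδ' : (12 : ℤ) * (N * (δ + r) + (δ + r)) ≤ L' := by exact_mod_cast hNδ
  have hρL' : (10 : ℤ) * (ρ + 1) ≤ L' := by exact_mod_cast hρL
  have hL3 : (3 : ℤ) * L'' ≤ 4 * L' := by exact_mod_cast hL2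
  have hδ0' : (0 : ℤ) < δ := by exact_mod_cast hδ0
  have hr0 : (0 : ℤ) ≤ r := by positivity
  -- the halving step for a box, given the log-Sobolev constant `c'` of its halves
  have halve : ∀ (a b : Site 2) (j : Fin 2) (c' : ℝ), 0 ≤ c' → (∀ i, a i < b i) →
      (L' : ℤ) < b j - a j → b j - a j ≤ L'' → (∀ i, i ≠ j → (ρ : ℤ) + 1 ≤ b i - a i) →
      (∀ i, b i - a i ≤ L'') →
      (∀ (a' b' : Site 2), (∀ i, i ≠ j → a' i = a i ∧ b' i = b i) → a j ≤ a' j → b' j ≤ b j →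
        (b j - a j) / 2 - N * (δ + r) ≤ b' j - a' j → b' j - a' j ≤ (b j - a j) / 2 + N * (δ + r) + 1 →
        (Fintype.piFinset fun i => Finset.Ico ((a') i) ((b') i)) ∈ fatRectangles (L' + L'') ∧
        ∀ φ : Site 2 → ℤˣ, LogSobolevIneq (U.spec β (Fintype.piFinset fun i => Finset.Ico ((a') i) ((b') i)) φ)
          (Fintype.piFinset fun i => Finset.Ico ((a') i) ((b') i)) c') →
      ∀ τ : Site 2 → ℤˣ, LogSobolevIneq (U.spec β (Fintype.piFinset fun i => Finset.Ico ((a) i) ((b) i)) τ)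
        (Fintype.piFinset fun i => Finset.Ico ((a) i) ((b) i)) (F * c') := by
    intro a b j c' hc' hpos hLj hjL2 hwide hall hhalves τ
    set ℓ := b j - a j with hℓ
    set c := a j + ℓ / 2 with hc
    have hℓ2 : ℓ / 2 ≤ ℓ - ℓ / 2 ∧ ℓ - ℓ / 2 ≤ ℓ / 2 + 1 ∧ 0 ≤ ℓ / 2 := by omega
    have hcard : ((Fintype.piFinset fun i => Finset.Ico ((a) i) ((b) i))).card ≤ 4 * L' ^ 2 := by
      rw [card_IcoBox, Fin.prod_univ_two]
      have h0 : (b 0 - a 0).toNat ≤ 2 * L' := by have := hall 0; omega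
      have h1 : (b 1 - a 1).toNat ≤ 2 * L' := by have := hall 1; omega
      calc (b 0 - a 0).toNat * (b 1 - a 1).toNat ≤ (2 * L') * (2 * L') := Nat.mul_le_mul h0 h1
        _ = 4 * L' ^ 2 := by ring
    have hcle : a j ≤ c := by rw [hc]; omega
    have hNℓ : (N : ℤ) * (δ + r) ≤ ℓ - ℓ / 2 := by nlinarith [hℓ2.1, hNδ', hLj]
    have hend : c + N * (δ + r) ≤ b j := by rw [hc]; omega
    have hwin : ∀ n : ℕ, n < N → (n : ℤ) * (δ + r) + (δ + r) ≤ N * (δ + r) ∧ (0 : ℤ) ≤ n * (δ + r) := by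
      intro n hn
      have hn' : (n : ℤ) + 1 ≤ N := by exact_mod_cast hn
      exact ⟨by nlinarith, by positivity⟩
    have hTopW : ∀ n : ℕ, n < N →
        (Fintype.piFinset fun i => Finset.Ico ((Function.update a j (c + n * (δ + r))) i) ((b) i)) ∈
          fatRectangles (L' + L'') ∧
        ∀ φ : Site 2 → ℤˣ,
        LogSobolevIneq (U.spec β (Fintype.piFinset fun i => Finset.Ico ((Function.update a j (c + n * (δ + r))) i) ((b) i)) φ)
          (Fintype.piFinset fun i => Finset.Ico ((Function.update a j (c + n * (δ + r))) i) ((b) i)) c' := by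
      intro n hn
      obtain ⟨hnδ, hnδ0⟩ := hwin n hn
      refine hhalves _ _ (fun i hi => ⟨by rw [Function.update_of_ne hi], rfl⟩) ?_ le_rfl ?_ ?_
      · rw [Function.update_self]; omega
      · rw [Function.update_self]; omega
      · rw [Function.update_self]; omega
    have hBotW : ∀ n : ℕ, n < N →
        (Fintype.piFinset fun i => Finset.Ico ((a) i) ((Function.update b j (c + n * (δ + r) + δ)) i)) ∈
          fatRectangles (L' + L'') ∧
        ∀ φ : Site 2 → ℤˣ,
        LogSobolevIneq (U.spec β (Fintype.piFinset fun i => Finset.Ico ((a) i) ((Function.update b j (c + n * (δ + r) + δ)) i)) φ)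
          (Fintype.piFinset fun i => Finset.Ico ((a) i) ((Function.update b j (c + n * (δ + r) + δ)) i)) c' := by
      intro n hn
      obtain ⟨hnδ, hnδ0⟩ := hwin n hn
      refine hhalves _ _ (fun i hi => ⟨rfl, by rw [Function.update_of_ne hi]⟩) le_rfl ?_ ?_ ?_
      · rw [Function.update_self]; omega
      · rw [Function.update_self]; omega
      · rw [Function.update_self]; omega
    have h := logSobolevIneq_box_of_halves_fat U β hR1 hR hm hSMT (a := a) (b := b) (j := j) (c := c) hN hδ0
      hcle hend hρ2 hρδ hρl hwide hcard hκdef hκ hk hm' hGB (Lb := L' + L'') (fun n hn => (hBotW n hn).1)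
      hc' (fun n hn => (hTopW n hn).2) (fun n hn => (hBotW n hn).2) τ
    refine h.mono (le_of_eq ?_)
    rw [hF]; ring
  -- now the rectangles of `𝓡_{L''}`
  intro Q hQ τ
  obtain ⟨a, b, rfl, hpos, hfat, hle⟩ := exists_IcoBox_of_mem_fatRectangles hQ
  by_cases hsmall : ∀ i, b i - a i ≤ L'
  · -- already in `𝓡_{L'}`
    exact (hLSI _ (IcoBox_mem_fatRectangles hpos hfat hsmall) τ).mono (hcF.trans hFF)
  rw [not_forall] at hsmall
  obtain ⟨j₀, hj₀⟩ := hsmall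
  rw [not_le] at hj₀
  -- the longest side `j`
  obtain ⟨j, hlong, hLj⟩ : ∃ j : Fin 2, (∀ i, b i - a i ≤ b j - a j) ∧ (L' : ℤ) < b j - a j := by
    by_cases h01 : b 0 - a 0 ≤ b 1 - a 1
    · refine ⟨1, fun i => ?_, ?_⟩
      · fin_cases i
        · exact h01
        · exact le_rfl
      · fin_cases j₀
        · exact lt_of_lt_of_le hj₀ h01
        · exact hj₀
    · rw [not_le] at h01
      refine ⟨0, fun i => ?_, ?_⟩
      · fin_cases i
        · exact le_rfl
        · exact h01.le
      · fin_cases j₀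
        · exact hj₀
        · exact lt_trans hj₀ h01
  have hwide : ∀ i, i ≠ j → (ρ : ℤ) + 1 ≤ b i - a i := by
    intro i _
    have h1 := hfat j i
    nlinarith [hLj, hρL']
  -- the halves have constant `F c_s` (case a): in `𝓡_{L'}`; case b): split once more along the other side)
  refine (halve a b j (F * cs) (mul_nonneg hF0 hcs) hpos hLj (hle j) hwide hle ?_ τ).mono (le_of_eq (by ring))
  intro a' b' hother ha' hb' hlow hupp
  -- sides of the half `H = Π[a'_i, b'_i)`
  have hℓ2 : (b j - a j) / 2 ≤ (b j - a j) - (b j - a j) / 2 ∧ 0 ≤ (b j - a j) / 2 ∧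
      2 * ((b j - a j) / 2) ≤ b j - a j ∧ b j - a j - 1 ≤ 2 * ((b j - a j) / 2) := by omega
  have hHj_le : b' j - a' j ≤ L' := by linarith [hupp, hle j, hL3, hNδ', hℓ2.2.2.1, hδ0', hr0]
  have hHj_ge : 5 * (b j - a j) ≤ 12 * (b' j - a' j) := by
    linarith [hlow, hNδ', hLj, hℓ2.2.2.2, hδ0', hr0]
  have hHside : ∀ i, i ≠ j → b' i - a' i = b i - a i := fun i hi => by rw [(hother i hi).1, (hother i hi).2]
  have hHpos : ∀ i, a' i < b' i := by
    intro i
    by_cases hi : i = j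
    · subst hi; nlinarith [hHj_ge, hLj]
    · rw [(hother i hi).1, (hother i hi).2]; exact hpos i
  have hHfat : ∀ i i', b' i - a' i ≤ 10 * (b' i' - a' i') := by
    intro i i'
    by_cases hi : i = j <;> by_cases hi' : i' = j
    · rw [hi, hi']; linarith [hHj_ge, hLj]
    · rw [hi, hHside i' hi']
      have := hfat j i'
      linarith [hupp, hℓ2.2.2.1, hNδ', hLj, hδ0', hρL', hr0]
    · rw [hi', hHside i hi]
      linarith [hlong i, hHj_ge]
    · rw [hHside i hi, hHside i' hi']; exact hfat i i'
  have hHall : ∀ i', b' i' - a' i' ≤ L' + L'' := by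
    intro i'
    by_cases hi' : i' = j
    · rw [hi']; have : (0 : ℤ) ≤ L'' := by positivity
      linarith [hHj_le]
    · rw [hHside i' hi']; have : (0 : ℤ) ≤ L' := by positivity
      linarith [hle i']
  refine ⟨IcoBox_mem_fatRectangles hHpos hHfat hHall, fun φ => ?_⟩
  by_cases hcase : ∀ i, i ≠ j → b i - a i ≤ L'
  · -- case a): the half lies in `𝓡_{L'}`
    have hHle : ∀ i, b' i - a' i ≤ L' := by
      intro i
      by_cases hi : i = j
      · subst hi; exact hHj_le
      · rw [hHside i hi]; exact hcase i hi
    exact (hLSI _ (IcoBox_mem_fatRectangles hHpos hHfat hHle) φ).mono hcF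
  · -- case b): the other side `i` is longer than `L'`; split the half along `i`
    rw [not_forall] at hcase
    obtain ⟨i, hi⟩ := hcase
    rw [Classical.not_imp, not_le] at hi
    obtain ⟨hij, hLi⟩ := hi
    have hother_eq : ∀ i' : Fin 2, i' ≠ i → i' = j := by
      intro i' hi'i
      have h1 := Fin.val_ne_of_ne hi'i
      have h2 := Fin.val_ne_of_ne hij
      apply Fin.ext
      have := i.isLt; have := j.isLt; have := i'.isLt
      omega
    have hHlong_i : (L' : ℤ) < b' i - a' i := by rw [hHside i hij]; exact hLi
    have hHall' : ∀ i', b' i' - a' i' ≤ L'' := by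
      intro i'
      by_cases hi' : i' = j
      · rw [hi']; linarith [hupp, hle j, hℓ2.2.2.1, hNδ', hLj, hδ0', hr0]
      · rw [hHside i' hi']; exact hle i'
    have hHwide : ∀ i', i' ≠ i → (ρ : ℤ) + 1 ≤ b' i' - a' i' := by
      intro i' hi'i
      rw [hother_eq i' hi'i]
      nlinarith [hHj_ge, hLj, hρL']
    refine halve a' b' i cs hcs hHpos hHlong_i (hHall' i) hHwide hHall' ?_ φ
    -- the quarters lie in `𝓡_{L'}`
    intro a'' b'' hother' ha'' hb'' hlow' hupp'
    have hℓi2 : (b' i - a' i) / 2 ≤ (b' i - a' i) - (b' i - a' i) / 2 ∧ 0 ≤ (b' i - a' i) / 2 ∧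
        2 * ((b' i - a' i) / 2) ≤ b' i - a' i ∧ b' i - a' i - 1 ≤ 2 * ((b' i - a' i) / 2) := by omega
    have hKi_le : b'' i - a'' i ≤ L' := by linarith [hupp', hHall' i, hL3, hNδ', hℓi2.2.2.1, hδ0', hr0]
    have hKi_ge : 5 * (b' i - a' i) ≤ 12 * (b'' i - a'' i) := by
      linarith [hlow', hNδ', hHlong_i, hℓi2.2.2.2, hδ0', hr0]
    have hKside : ∀ i', i' ≠ i → b'' i' - a'' i' = b' i' - a' i' := fun i' hi' => by
      rw [(hother' i' hi').1, (hother' i' hi').2]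
    have hKpos : ∀ i', a'' i' < b'' i' := by
      intro i'
      by_cases hi' : i' = i
      · subst hi'; nlinarith [hKi_ge, hHlong_i]
      · rw [(hother' i' hi').1, (hother' i' hi').2]; exact hHpos i'
    have hKle : ∀ i', b'' i' - a'' i' ≤ L' := by
      intro i'
      by_cases hi' : i' = i
      · subst hi'; exact hKi_le
      · rw [hKside i' hi', hother_eq i' hi']; exact hHj_le
    have hlowb : ∀ i', 5 * (L' : ℤ) ≤ 12 * (b'' i' - a'' i') := by
      intro i'
      by_cases hi' : i' = i
      · subst hi'; nlinarith [hKi_ge, hHlong_i]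
      · rw [hKside i' hi', hother_eq i' hi']; nlinarith [hHj_ge, hLj]
    have hKfat : ∀ i₁ i₂, b'' i₁ - a'' i₁ ≤ 10 * (b'' i₂ - a'' i₂) := by
      intro i₁ i₂
      nlinarith [hlowb i₂, hKle i₁]
    have hKall : ∀ i', b'' i' - a'' i' ≤ L' + L'' := by
      intro i'; have : (0 : ℤ) ≤ L'' := by positivity
      linarith [hKle i']
    exact ⟨IcoBox_mem_fatRectangles hKpos hKfat hKall, fun ψ => hLSI _ (IcoBox_mem_fatRectangles hKpos hKfat hKle) ψ⟩

end Glauber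

end Literature.Probability.LatticeModels

end
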